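import Summits.AtomisticToContinuum.Crystallization.Theorems.FrustratedLawDichotomyCellTEQ15Data

/-!
# FrustratedLawDichotomy · crux `AperiodicFrustratedLawGap` (stmt-AtomisticToContinuum-27623) — TEQ15 witness cell: class 1 sums C
# (decomp-a2c, prover hand 2, generation 17; each theorem ONE `decide +kernel`, split for the farm's per-declaration budget). [folklore]
-/

namespace Summit.AtomisticToContinuum.Crystallization.Theorems.FrustratedLawDichotomyCellTEQ15

open scoped BigOperators
open Summit.AtomisticToContinuum.Crystallization.Theorems.FrustratedLawDichotomyCellChecker
open Summit.AtomisticToContinuum.Crystallization.Theorems.FrustratedLawDichotomyCellKitX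

set_option maxHeartbeats 0 in
/-- Kernel value of the `C12` sum of class `1`. [folklore] -/
theorem teq15_sum1_C12 : sumX cellTEQ15 (termC cellTEQ15 cellTEQ15P cellTEQ15X1.bins 1 2 ⟨1, by decide⟩) = ((74112011201900151 : ℚ) / 262144000000000000) := by decide +kernel

set_option maxHeartbeats 0 in
/-- Kernel value of the `C22` sum of class `1`. [folklore] -/
theorem teq15_sum1_C22 : sumX cellTEQ15 (termC cellTEQ15 cellTEQ15P cellTEQ15X1.bins 2 2 ⟨1, by decide⟩) = ((745984054354321939 : ℚ) / 65536000000000000) := by decide +kernel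

set_option maxHeartbeats 0 in
/-- Kernel value of the `B0` sum of class `1`. [folklore] -/
theorem teq15_sum1_B0 : sumX cellTEQ15 (termB cellTEQ15 cellTEQ15P cellTEQ15X1.bins 0 ⟨1, by decide⟩) = ((222775325963 : ℚ) / 262144000000) := by decide +kernel

end Summit.AtomisticToContinuum.Crystallization.Theorems.FrustratedLawDichotomyCellTEQ15
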